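import Summits.BirchSwinnertonDyer.BirchSwinnertonDyer.Theorems.ResidualThetaTransportAtTwoCmLambdaLowerOfCorank
import HarnessLib

/-!
# S2 / RSL_g ⟸ the corank statement (f) ON THE FINITE BRANCH ONLY — the N7 entry point `cmLambdaLower_of_corank_of_finite`
# (k1-g2 H1), with the conclusion spelled VERBATIM (= the text of item stmt-BirchSwinnertonDyer-22608, no `Theses` import)

Route `ResidualThetaTransportAtTwo` (RTT), crux RSL_g `ResidualSignedLambdaLowerCMAtTwo` (stmt-BirchSwinnertonDyer-22608); STUB-PLAN rev 4 §3.2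
(«LAND FIRST: `Sketch_sidea_k1_g2.lean` l.53–88 → Theorems»), Q10. Seat `prover-bsd-wall-rtt-p2` g15 (`--supports`, closes nothing).
Adapted from the crux sketch `Cruxes/ResidualThetaCountLowerPureAtTwo/Sketch_sidea_k1_g2.lean` §A (stub-ideation k1 g2; kernel-checked there with the
conclusion BY NAME). THEOREMS ONLY; S2 / RSL_g is NOT proved here (the corank datum is the hypothesis); BSD is not proved by any of this.

* **`cmLambdaLower_of_corank_of_finite`** — same binders as `LambdaLowerBoundO.cmLambdaLower_of_corank` (w2, p645378), with ONE extra antecedent in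
  the hypothesis: the corank datum `(Sg, X, toDual, d + Σ_g(S₀) ≤ rank_𝒪 (X / X_tors))` is demanded only when the `ϖ`-torsion `𝒮[ϖ]` of the
  transported `S₀`-imprimitive plus-Selmer set is FINITE (on the infinite branch the registered `Set.encard` inequality is `_ ≤ ⊤`). On the finite
  branch every dual in sight is finitely generated over `𝒪` (`LambdaLowerBoundO.moduleFinite_of_finite_quotient`), so (f) is a statement about
  `Module.finrank` of honest `𝒪`-modules — the currency of the λ-assembly kit `…Theorems.CharIdealLambda` (`le_finrank_quotientTorsion_of_le_finrank_baseChange`,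
  `le_finrank_baseChange_of_fourTerm`, …). The conclusion is the item's text verbatim, so `exact cmLambdaLower_of_corank_of_finite h` closes RSL_g BY NAME
  in a file that imports the route.

References: [EmertonPollackWeston2006] Thm. 3.1.1; [GreenbergLNM1716] §4; [GreenbergVatsal2000] §2.
-/

set_option autoImplicit false
-- the Theorems namespace of this sub repeats the summit name by design (D-0017 nested layout)
set_option linter.dupNamespace false
-- the 3900-character binder blocks of the registered S2 signature need more than the default budget to elaborate (as in w2's p645378)
set_option maxHeartbeats 800000

noncomputable section

open scoped Classical

namespace Summit.BirchSwinnertonDyer.BirchSwinnertonDyer.Theorems.LambdaLowerBoundO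

-- adapted from Cruxes/ResidualThetaCountLowerPureAtTwo/Sketch_sidea_k1_g2.lean §A (stub-ideation k1 g2)

open Literature.NumberTheory.EllipticCurves Literature.NumberTheory.EllipticCurves.GreenbergSelmer
open Literature.NumberTheory.GaloisRepresentations NumberField IsDedekindDomain Field
open Literature.NumberTheory.EllipticCurves GreenbergSelmer GreenbergVatsal2000 Kobayashi2003 ModularForms Rank1Residual Literature.NumberTheory.GaloisRepresentations Literature.NumberTheory.Automorphic IsDedekindDomain NumberField Field Rat.HeightOneSpectrum PowerSeries

/-- **H1 (k1-g2 Plan 1). RSL_g ⟸ (f) ON THE FINITE BRANCH ONLY.** Same binders as `cmLambdaLower_of_corank` (w2), with the corank datum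
`(Sg, X, toDual, d + Σ_g(S₀) ≤ rank_𝒪 (X / X_tors))` required only when the `ϖ`-torsion `𝒮[ϖ]` of the transported `S₀`-imprimitive plus-Selmer set
is FINITE; conclusion = the text of RSL_g (stmt-BirchSwinnertonDyer-22608) VERBATIM (`Set.encard` form). Proof: on the finite branch
`pow_le_encard_of_dualPair_of_subset`; on the infinite branch `encard = ⊤`. [cite: EmertonPollackWeston2006, Thm. 3.1.1] [cite: GreenbergLNM1716, §4 p. 98] -/
theorem cmLambdaLower_of_corank_of_finite
    (hcorank : ∀ (W : WeierstrassCurve ℚ) [W.IsElliptic] [W.IsGloballyMinimal], ¬ W.HasCM → W.analyticRank = 0 → GoodSS W 2 → W.frobeniusTrace 2 = 0 → W.Δ < 0 → ∀ (M : ℕ) [NeZero M] (g : CuspForm (CongruenceSubgroup.Gamma0 M) 2) (ι : coeffField g →+* PadicAlgCl 2) (Ω : ℂ), Odd M → IsNewform0 g → IsCMForm (liftToGamma1 M 2 g) → cuspCoeff g 2 = 0 → IsCohomologicalPlusPeriod g ι Ω → (∀ ℓ : ℕ, ℓ.Prime → ¬ ℓ ∣ 2 * M * W.conductorNorm ℤ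 → ‖embCoeff g ι ℓ - (W.frobeniusTrace ℓ : PadicAlgCl 2)‖ < 1) → ∀ (κ : ZpExtension ℚ 2) (γ : absoluteGaloisGroup ℚ), κ.IsCyclotomic → κ.IsTopGenerator γ → IsCyclotomicVariable 2 γ → ∀ (S₀ : Finset (HeightOneSpectrum (RingOfIntegers ℚ))), (∀ v ∈ S₀, ((2 : ℕ) : RingOfIntegers ℚ) ∉ v.asIdeal) → (∀ v, ¬ W.HasGoodReductionAt v → v ∈ S₀) → (∀ v, natGenerator v ∣ M → v ∈ S₀) → ∀ (Lp Lm : IwasawaAlgebraO (Set.range ι)) (d : ℕ), IsPollackPairK g ι Ω Lp Lm → (∀ k, ‖coeff k (iwasawaOToPowerSeries (Set.range ι) Lm)‖ ≤ ‖coeff d (iwasawaOToPowerSeries (Set.range ι) Lm)‖) → (∀ k < d, ‖coeff k (iwasawaOToPowerSeries (Set.range ι) Lm)‖ < ‖coeff d (iwasawaOToPowerSeries (Set.range ι) Lm)‖) → ∀ (n : ℕ) (ρ : FramedGaloisRep ℚ ↥(padicCoeffIntegers (Set.range ι)) 2) (Θ : ∀ v : HeightOneSpectrum (RingOfIntegers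 ℚ), ((2 : ℕ) : RingOfIntegers ℚ) ∈ v.asIdeal → (Cofree ρ ↥(padicCoeffField (Set.range ι)) ≃+ (Fin n → ↥(W.geomPrimaryTorsion 2)))), (∀ v, ¬ natGenerator v ∣ 2 * M → ρ.IsUnramifiedAt v ∧ ∃ P : Polynomial ↥(padicCoeffIntegers (Set.range ι)), P.map (padicCoeffIntegers (Set.range ι)).subtype = Polynomial.X ^ 2 - Polynomial.C (embCoeff g ι (natGenerator v)) * Polynomial.X + Polynomial.C ((natGenerator v : ℕ) : PadicAlgCl 2) ∧ ρ.HasFrobCharpolyAt v P) → (∀ v hv (δ : absoluteGaloisGroup (v.adicCompletion ℚ)) m i, Θ v hv (resGalOfEmb (closureEmb (K := ℚ) (v.adicCompletion ℚ)) δ • m) i = resGalOfEmb (closureEmb (K := ℚ) (v.adicCompletion ℚ)) δ • Θ v hv m i) → ∀ (ϖ : ↥(padicCoeffIntegers (Set.range ι))), Irreducible ϖ → {y : subgroupH1 κ.kerSubgroup (Cofree ρ ↥(padicCoeffField (Set.range ι))) | y ∈ unramifiedOutside κ.kerSubgroup (Cofree ρ ↥(padicCoeffField (Set.range ι))) 2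 ↑S₀ ∧ (∀ w σ, conjH1 κ.kerSubgroup (Cofree ρ ↥(padicCoeffField (Set.range ι))) σ y ∈ infKer κ.kerSubgroup (Cofree ρ ↥(padicCoeffField (Set.range ι))) w) ∧ (∀ v hv σ, ∃ (φ : _) (Q : Fin n → localPoints W (v.adicCompletion ℚ)) (k : ℕ), oneCocycleClass (discreteTopRep ↥κ.kerSubgroup (Cofree ρ ↥(padicCoeffField (Set.range ι)))) φ = conjH1 κ.kerSubgroup (Cofree ρ ↥(padicCoeffField (Set.range ι))) σ y ∧ (∀ i, (2 ^ k) • Q i ∈ ⨆ m : ℕ, signedLocalPoints κ (v.adicCompletion ℚ) W 1 m) ∧ ∀ τ i, pointsMapOfEmb W (closureEmb (K := ℚ) (v.adicCompletion ℚ)) (((Θ v hv (φ.1 (resGalSubgroupOfEmb κ.kerSubgroup (closureEmb (K := ℚ) (v.adicCompletion ℚ)) τ))) i : ↥(W.geomPrimaryTorsion 2)) : W.geomPoints) = (τ : absoluteGaloisGroup (v.adicCompletion ℚ)) • Q i - Q i) ∧ scalarH1 κ.kerSubgroup (Cofree ρ ↥(padicCoeffField (Set.range ι))) ϖ y = 0}.Finite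 → ∃ (Sg : AddSubgroup (subgroupH1 κ.kerSubgroup (Cofree ρ ↥(padicCoeffField (Set.range ι))))), (↑Sg : Set (subgroupH1 κ.kerSubgroup (Cofree ρ ↥(padicCoeffField (Set.range ι))))) ⊆ {y : subgroupH1 κ.kerSubgroup (Cofree ρ ↥(padicCoeffField (Set.range ι))) | y ∈ unramifiedOutside κ.kerSubgroup (Cofree ρ ↥(padicCoeffField (Set.range ι))) 2 ↑S₀ ∧ (∀ w σ, conjH1 κ.kerSubgroup (Cofree ρ ↥(padicCoeffField (Set.range ι))) σ y ∈ infKer κ.kerSubgroup (Cofree ρ ↥(padicCoeffField (Set.range ι))) w) ∧ (∀ v hv σ, ∃ (φ : _) (Q : Fin n → localPoints W (v.adicCompletion ℚ)) (k : ℕ), oneCocycleClass (discreteTopRep ↥κ.kerSubgroup (Cofree ρ ↥(padicCoeffField (Set.range ι)))) φ = conjH1 κ.kerSubgroup (Cofree ρ ↥(padicCoeffField (Set.range ι))) σ y ∧ (∀ i, (2 ^ k) • Q i ∈ ⨆ m : ℕ, signedLocalPoints κ (v.adicCompletion ℚ) W 1 m) ∧ ∀ τ i, pointsMapOfEmb W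 (closureEmb (K := ℚ) (v.adicCompletion ℚ)) (((Θ v hv (φ.1 (resGalSubgroupOfEmb κ.kerSubgroup (closureEmb (K := ℚ) (v.adicCompletion ℚ)) τ))) i : ↥(W.geomPrimaryTorsion 2)) : W.geomPoints) = (τ : absoluteGaloisGroup (v.adicCompletion ℚ)) • Q i - Q i)} ∧ (∀ (r : ↥(padicCoeffIntegers (Set.range ι))) (c : subgroupH1 κ.kerSubgroup (Cofree ρ ↥(padicCoeffField (Set.range ι)))), c ∈ Sg → scalarH1 κ.kerSubgroup (Cofree ρ ↥(padicCoeffField (Set.range ι))) r c ∈ Sg) ∧ ∃ (X : Type) (_ : AddCommGroup X) (_ : Module (IwasawaAlgebraO (Set.range ι)) X) (_ : Module ↥(padicCoeffIntegers (Set.range ι)) X) (_ : IsScalarTower ↥(padicCoeffIntegers (Set.range ι)) (IwasawaAlgebraO (Set.range ι)) X) (_ : Module.Finite (IwasawaAlgebraO (Set.range ι)) X) (toDual : X →+ (↥Sg →+ AddCircle (1 : ℚ))), Function.Bijective toDual ∧ (∀ (a : ↥(padicCoeffIntegers (Set.range ι))) (x : X) (s : ↥Sg) (hs : scalarH1 κ.kerSubgroup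 (Cofree ρ ↥(padicCoeffField (Set.range ι))) a (s : subgroupH1 κ.kerSubgroup (Cofree ρ ↥(padicCoeffField (Set.range ι)))) ∈ Sg), toDual ((PowerSeries.C a : IwasawaAlgebraO (Set.range ι)) • x) s = toDual x ⟨scalarH1 κ.kerSubgroup (Cofree ρ ↥(padicCoeffField (Set.range ι))) a (s : subgroupH1 κ.kerSubgroup (Cofree ρ ↥(padicCoeffField (Set.range ι)))), hs⟩) ∧ (d + ∑ v ∈ S₀, 2 ^ padicValNat 2 ((natGenerator v ^ 2 - 1) / 8) * (if natGenerator v ∣ M then (if ‖embCoeff g ι (natGenerator v) - 1‖ < 1 then 1 else 0) else (if ‖embCoeff g ι (natGenerator v)‖ < 1 then 2 else 0))) ≤ Module.finrank ↥(padicCoeffIntegers (Set.range ι)) (X ⧸ Submodule.torsion ↥(padicCoeffIntegers (Set.range ι)) X)) :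
    open Literature.NumberTheory.EllipticCurves GreenbergSelmer GreenbergVatsal2000 Kobayashi2003 ModularForms Rank1Residual Literature.NumberTheory.GaloisRepresentations Literature.NumberTheory.Automorphic IsDedekindDomain NumberField Field Rat.HeightOneSpectrum PowerSeries in ∀ (W : WeierstrassCurve ℚ) [W.IsElliptic] [W.IsGloballyMinimal], ¬ W.HasCM → W.analyticRank = 0 → GoodSS W 2 → W.frobeniusTrace 2 = 0 → W.Δ < 0 → ∀ (M : ℕ) [NeZero M] (g : CuspForm (CongruenceSubgroup.Gamma0 M) 2) (ι : coeffField g →+* PadicAlgCl 2) (Ω : ℂ), Odd M → IsNewform0 g → IsCMForm (liftToGamma1 M 2 g) → cuspCoeff g 2 = 0 → IsCohomologicalPlusPeriod g ι Ω → (∀ ℓ : ℕ, ℓ.Prime → ¬ ℓ ∣ 2 * M * W.conductorNorm ℤ → ‖embCoeff g ι ℓ - (W.frobeniusTrace ℓ : PadicAlgCl 2)‖ < 1) → ∀ (κ : ZpExtension ℚ 2) (γ : absoluteGaloisGroup ℚ), κ.IsCyclotomic → κ.IsTopGenerator γ → IsCyclotomicVariable 2 γ → ∀ (S₀ : Finset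 (HeightOneSpectrum (RingOfIntegers ℚ))), (∀ v ∈ S₀, ((2 : ℕ) : RingOfIntegers ℚ) ∉ v.asIdeal) → (∀ v, ¬ W.HasGoodReductionAt v → v ∈ S₀) → (∀ v, natGenerator v ∣ M → v ∈ S₀) → ∀ (Lp Lm : IwasawaAlgebraO (Set.range ι)) (d : ℕ), IsPollackPairK g ι Ω Lp Lm → (∀ k, ‖coeff k (iwasawaOToPowerSeries (Set.range ι) Lm)‖ ≤ ‖coeff d (iwasawaOToPowerSeries (Set.range ι) Lm)‖) → (∀ k < d, ‖coeff k (iwasawaOToPowerSeries (Set.range ι) Lm)‖ < ‖coeff d (iwasawaOToPowerSeries (Set.range ι) Lm)‖) → ∀ (n : ℕ) (ρ : FramedGaloisRep ℚ ↥(padicCoeffIntegers (Set.range ι)) 2) (Θ : ∀ v : HeightOneSpectrum (RingOfIntegers ℚ), ((2 : ℕ) : RingOfIntegers ℚ) ∈ v.asIdeal → (Cofree ρ ↥(padicCoeffField (Set.range ι)) ≃+ (Fin n → ↥(W.geomPrimaryTorsion 2)))), (∀ v, ¬ natGenerator v ∣ 2 * M → ρ.IsUnramifiedAt v ∧ ∃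 P : Polynomial ↥(padicCoeffIntegers (Set.range ι)), P.map (padicCoeffIntegers (Set.range ι)).subtype = Polynomial.X ^ 2 - Polynomial.C (embCoeff g ι (natGenerator v)) * Polynomial.X + Polynomial.C ((natGenerator v : ℕ) : PadicAlgCl 2) ∧ ρ.HasFrobCharpolyAt v P) → (∀ v hv (δ : absoluteGaloisGroup (v.adicCompletion ℚ)) m i, Θ v hv (resGalOfEmb (closureEmb (K := ℚ) (v.adicCompletion ℚ)) δ • m) i = resGalOfEmb (closureEmb (K := ℚ) (v.adicCompletion ℚ)) δ • Θ v hv m i) → ∀ (ϖ : ↥(padicCoeffIntegers (Set.range ι))), Irreducible ϖ → ((Nat.card (↥(padicCoeffIntegers (Set.range ι)) ⧸ Ideal.span {ϖ}) ^ (d + ∑ v ∈ S₀, 2 ^ padicValNat 2 ((natGenerator v ^ 2 - 1) / 8) * (if natGenerator v ∣ M then (if ‖embCoeff g ι (natGenerator v) - 1‖ < 1 then 1 else 0) else (if ‖embCoeff g ι (natGenerator v)‖ < 1 then 2 else 0))) : ℕ) : ℕ∞) ≤ {y : subgroupH1 κ.kerSubgroup (Cofree ρ ↥(padicCoeffField (Set.range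 ι))) | y ∈ unramifiedOutside κ.kerSubgroup (Cofree ρ ↥(padicCoeffField (Set.range ι))) 2 ↑S₀ ∧ (∀ w σ, conjH1 κ.kerSubgroup (Cofree ρ ↥(padicCoeffField (Set.range ι))) σ y ∈ infKer κ.kerSubgroup (Cofree ρ ↥(padicCoeffField (Set.range ι))) w) ∧ (∀ v hv σ, ∃ (φ : _) (Q : Fin n → localPoints W (v.adicCompletion ℚ)) (k : ℕ), oneCocycleClass (discreteTopRep ↥κ.kerSubgroup (Cofree ρ ↥(padicCoeffField (Set.range ι)))) φ = conjH1 κ.kerSubgroup (Cofree ρ ↥(padicCoeffField (Set.range ι))) σ y ∧ (∀ i, (2 ^ k) • Q i ∈ ⨆ m : ℕ, signedLocalPoints κ (v.adicCompletion ℚ) W 1 m) ∧ ∀ τ i, pointsMapOfEmb W (closureEmb (K := ℚ) (v.adicCompletion ℚ)) (((Θ v hv (φ.1 (resGalSubgroupOfEmb κ.kerSubgroup (closureEmb (K := ℚ) (v.adicCompletion ℚ)) τ))) i : ↥(W.geomPrimaryTorsion 2)) : W.geomPoints) = (τ : absoluteGaloisGroup (v.adicCompletion ℚ)) • Q i - Q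 i) ∧ scalarH1 κ.kerSubgroup (Cofree ρ ↥(padicCoeffField (Set.range ι))) ϖ y = 0}.encard := by
  intro W _ _ hCM hr0 hss ha2 hΔ M _ g ι Ω hM hnew hcmf ha2g hΩ hcong κ γ hκ hγ hcyc S₀ hS₀ hbad hMS Lp Lm d hpair
    hle hlt n ρ Θ hρ hΘ ϖ hϖ
  by_cases hfin : ({y : subgroupH1 κ.kerSubgroup (Cofree ρ ↥(padicCoeffField (Set.range ι))) | y ∈ unramifiedOutside κ.kerSubgroup (Cofree ρ ↥(padicCoeffField (Set.range ι))) 2 ↑S₀ ∧ (∀ w σ, conjH1 κ.kerSubgroup (Cofree ρ ↥(padicCoeffField (Set.range ι))) σ y ∈ infKer κ.kerSubgroup (Cofree ρ ↥(padicCoeffField (Set.range ι))) w) ∧ (∀ v hv σ, ∃ (φ : _) (Q : Fin n → localPoints W (v.adicCompletion ℚ)) (k : ℕ), oneCocycleClass (discreteTopRep ↥κ.kerSubgroup (Cofree ρ ↥(padicCoeffField (Set.range ι)))) φ = conjH1 κ.kerSubgroup (Cofree ρ ↥(padicCoeffField (Set.range ι))) σ y ∧ (∀ i, (2 ^ k)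 • Q i ∈ ⨆ m : ℕ, signedLocalPoints κ (v.adicCompletion ℚ) W 1 m) ∧ ∀ τ i, pointsMapOfEmb W (closureEmb (K := ℚ) (v.adicCompletion ℚ)) (((Θ v hv (φ.1 (resGalSubgroupOfEmb κ.kerSubgroup (closureEmb (K := ℚ) (v.adicCompletion ℚ)) τ))) i : ↥(W.geomPrimaryTorsion 2)) : W.geomPoints) = (τ : absoluteGaloisGroup (v.adicCompletion ℚ)) • Q i - Q i) ∧ scalarH1 κ.kerSubgroup (Cofree ρ ↥(padicCoeffField (Set.range ι))) ϖ y = 0} : Set _).Finite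
  · obtain ⟨Sg, hSg𝒮, hscal, X, iX, iΛ, i𝒪, iT, iF, toDual, hbij, hC, hrank⟩ :=
      hcorank W hCM hr0 hss ha2 hΔ M g ι Ω hM hnew hcmf ha2g hΩ hcong κ γ hκ hγ hcyc S₀ hS₀ hbad hMS Lp Lm d hpair
        hle hlt n ρ Θ hρ hΘ ϖ hϖ hfin
    haveI : FiniteDimensional ℚ (ModularForms.coeffField g) :=
      ModularForms.IsNewform0.finiteDimensional_coeffField_holds hnew
    haveI : FiniteDimensional ℚ_[2] ↥(padicCoeffField (Set.range ι)) :=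
      GreenbergSelmer.finiteDimensional_padicCoeffField ι
    have key := pow_le_encard_of_dualPair_of_subset (Set.range ι) κ ρ Sg (fun r _ hc ↦ hscal r _ hc) _ hSg𝒮 X
      toDual hbij (fun a x s ↦ hC a x s (hscal a _ s.2)) ϖ hϖ _ hrank
    refine le_of_le_of_eq key (congrArg Set.encard (Set.ext fun y ↦ ?_))
    constructor
    · rintro ⟨⟨h1, h2, h3⟩, h4⟩
      exact ⟨h1, h2, h3, h4⟩
    · rintro ⟨h1, h2, h3, h4⟩
      exact ⟨⟨h1, h2, h3⟩, h4⟩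
  · rw [Set.Infinite.encard_eq hfin]
    exact le_top

end Summit.BirchSwinnertonDyer.BirchSwinnertonDyer.Theorems.LambdaLowerBoundO

end
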